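import Mathlib
import HarnessLib

/-!
# ζ(5) search — cells: the generalised "vanishing in the middle" family on `M_{0,10}` and its leading coefficient

HONEST FRAMING: systematic search; no irrationality claim unless certified.

OUR work (Summit side; family designer `brown9`, `families/brown9/FAMILY.md`). The configuration is Brown's
"vanishing in the middle" seating plan `σ = (10,2,4,1,6,3,8,5,9,7)` on `M_{0,10}` (arXiv:1412.6508, App. 2 §10.2.6;
Brown–Zudilin arXiv:2210.03391, Sect. 12; tree: `Literature…Brown2016.OddConfigurations.tenVanishingMiddle`,
`Literature…BrownZudilin2022.VanishingInTheMiddle.vimIntegral`). Following Brown 2016 §5.1 (generalised cellular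
integrals) we attach an exponent `a i` to the side `{i+1, i+2}` of the standard polygon `δ⁰ = (1,2,…,10)` and an
exponent `b j` to the side `{σ_{j+1}, σ_{j+2}}` of `σ` (indices mod 10; `a, b : Fin 10 → ℕ`, so `a 0 = a₁, …, a 9 = a₁₀`
in the notation of FAMILY.md). This file records, COMPUTABLY and with kernel-checked small cases:

* `Balanced a b` — the ten vertex balances (Möbius invariance of the integrand), `decide`d for the basic member;
* `Admissible a b` — Brown's absolute-convergence criterion specialised to this `σ` (the 10 positivity conditions are
  automatic for `ℕ`-valued `a`; the 16 genuine block inequalities of FAMILY.md §1 are listed), proved for every basic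
  member `a = b = (n,…,n)`;
* `leading a b : ℤ` — the terminating 6-fold binomial sum of FAMILY.md §2(c) (the constant term / torus residue of the
  integrand at a vertex of the polar cell, computed in the cubical chart of the frame `(3,8,5,9,7,10,2,4,1,6)`);
* `leading_basic_zero/one/two/three/four` — `leading n n = 1, 61, 52921, 94357501, 235634763001` for `n ≤ 4`,
  kernel-checked by `decide`. The first three integers are exactly the coefficients of `ζ_7 := 75/4·ζ(7) − 9ζ(5)ζ(2)` in the printed values `I₀, I₁, I₂` of
  Brown–Zudilin Sect. 12 (tree fact `BrownZudilin2022.vim_values`), which is the evidence — NOT a proof — for reading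
  `leading` as the leading coefficient `A(a,b)` of the family (FAMILY.md §2(c), status OBSERVED).

Nothing in this file is a statement about periods, integrals or zeta values: it is exact integer bookkeeping that the
Python tools of the seat (`code/brown9/`) are checked against (three implementations agree with these values and with
`A(3) = 94357501`, `A(4) = 235634763001`; the recurrence and asymptotics live in FAMILY.md §§4–5, unformalised).
-/

namespace Summit.KontsevichZagierPeriods.Zeta5Search.Cells.VanishingMiddleLeading

/-! ### Exponent data, balances, convergence polyhedron -/

/-- The ten vertex balances of FAMILY.md §1 (`v1 … v10`), for `a i` on the `δ⁰`-side `{i+1,i+2}` and `b j` on the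
`σ`-side number `j+1` of `σ = (10,2,4,1,6,3,8,5,9,7)`, i.e. `b 0 ↔ {10,2}, b 1 ↔ {2,4}, b 2 ↔ {4,1}, b 3 ↔ {1,6},
b 4 ↔ {6,3}, b 5 ↔ {3,8}, b 6 ↔ {8,5}, b 7 ↔ {5,9}, b 8 ↔ {9,7}, b 9 ↔ {7,10}`. -/
def Balanced (a b : Fin 10 → ℕ) : Prop :=
  a 9 + a 0 = b 2 + b 3 ∧ a 0 + a 1 = b 0 + b 1 ∧ a 1 + a 2 = b 4 + b 5 ∧ a 2 + a 3 = b 1 + b 2 ∧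
  a 3 + a 4 = b 6 + b 7 ∧ a 4 + a 5 = b 3 + b 4 ∧ a 5 + a 6 = b 8 + b 9 ∧ a 6 + a 7 = b 5 + b 6 ∧
  a 7 + a 8 = b 7 + b 8 ∧ a 8 + a 9 = b 0 + b 9

/-- `Balanced a b` is decidable (a conjunction of linear equalities over `ℕ`). -/
instance (a b : Fin 10 → ℕ) : Decidable (Balanced a b) := by unfold Balanced; infer_instance

/-- Brown's convergence criterion (arXiv:1412.6508 §3.4 with generalised exponents, §5.2) for this `σ`: the sixteen
non-automatic block inequalities of FAMILY.md §1 (blocks `234, 789, {1,10}, 1234, 789X, 123X; 2345, 3456, 567(8),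
6789, 19X, 12X, 12345, 789X(1), 189X, 129X`, `X = 10`). The ten conditions `a i ≥ 0` and the nine automatic ones are
vacuous over `ℕ`. -/
def Admissible (a b : Fin 10 → ℕ) : Prop :=
  b 1 ≤ a 1 + a 2 ∧ b 8 ≤ a 6 + a 7 ∧ b 0 ≤ a 0 + a 9 ∧ b 1 + b 2 ≤ a 0 + a 1 + a 2 ∧
  b 8 + b 9 ≤ a 6 + a 7 + a 8 ∧ b 0 + b 1 + b 2 ≤ a 0 + a 1 + a 2 + a 9 ∧
  b 1 ≤ a 1 + a 2 + a 3 + 1 ∧ b 4 ≤ a 2 + a 3 + a 4 + 1 ∧ b 6 ≤ a 4 + a 5 + a 6 + 1 ∧ b 8 ≤ a 5 + a 6 + a 7 + 1 ∧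
  b 0 ≤ a 0 + a 8 + a 9 + 1 ∧ b 0 ≤ a 0 + a 1 + a 9 + 1 ∧ b 1 + b 2 ≤ a 0 + a 1 + a 2 + a 3 + 1 ∧
  b 8 + b 9 ≤ a 6 + a 7 + a 8 + a 9 + 1 ∧ b 0 ≤ a 0 + a 7 + a 8 + a 9 + 2 ∧ b 0 ≤ a 0 + a 1 + a 8 + a 9 + 2

/-- `Admissible a b` is decidable (a conjunction of linear inequalities over `ℕ`). -/
instance (a b : Fin 10 → ℕ) : Decidable (Admissible a b) := by unfold Admissible; infer_instance

/-- The basic member `a = b = (n, …, n)` (Brown–Zudilin's `I_n`, tree `vimIntegral n`). -/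
def basic (n : ℕ) : Fin 10 → ℕ := fun _ => n

/-- Every basic member `a = b = (n,…,n)` is balanced. -/
theorem balanced_basic (n : ℕ) : Balanced (basic n) (basic n) := by
  unfold Balanced basic; omega

/-- Every basic member `a = b = (n,…,n)` satisfies Brown's convergence criterion. -/
theorem admissible_basic (n : ℕ) : Admissible (basic n) (basic n) := by
  unfold Admissible basic; omega

/-- The lattice condition singled out in FAMILY.md §1 (`a₁ + a₂ = a₈ + a₉`) follows from the balances. -/
theorem lattice_of_balanced {a b : Fin 10 → ℕ} (h : Balanced a b) : a 0 + a 1 = a 7 + a 8 := by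
  unfold Balanced at h; omega

/-! ### The leading coefficient as a terminating binomial sum -/

/-- `C(m, l)` computed as `m(m-1)⋯(m-l+1) / l!` — kernel-friendly (GMP numerals), equal to `Nat.choose`. -/
def binom (m l : ℕ) : ℕ := m.descFactorial l / l.factorial

/-- `binom m l = C(m,l)`. -/
theorem binom_eq_choose (m l : ℕ) : binom m l = m.choose l :=
  (Nat.choose_eq_descFactorial_div_factorial m l).symm

/-- `C(m + l, l)` for an integer `l`, with the convention `0` for `l < 0` (a vanished coefficient). -/
def shiftBinom (m : ℕ) (l : ℤ) : ℤ := if l < 0 then 0 else (binom (m + l.toNat) l.toNat : ℤ)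

/-- One term of the 6-fold sum of FAMILY.md §2(c): indices `k = (k₁,…,k₆)` with `k₁ ≤ a₈, k₂ ≤ a₇, k₃ ≤ a₄, k₄ ≤ a₉,
k₅ ≤ a₁₀, k₆ ≤ a₁` (the six binomial NUMERATOR factors of the cubical chart) and the seven geometric-series factors
`C(c_j + l_j, l_j)` with `(c₁,…,c₇) = (b₇, b₈, b₉, b₁₀, b₁, b₂, b₃)` and
`l₁ = b₆−k₁−k₂, l₂ = b₆+b₇−k₁−k₂−k₃, l₃ = a₇+b₈−k₂−k₃−k₄, l₄ = b₈+b₉−k₃−k₄, l₅ = a₈+b₁₀−k₃−k₅, l₆ = b₃+b₄−k₃−k₅−k₆,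
l₇ = b₄−k₅−k₆`. (0-based: `a₁ = a 0`, `b₁ = b 0`.) -/
def term (a b : Fin 10 → ℕ) (k₁ k₂ k₃ k₄ k₅ k₆ : ℕ) : ℤ :=
  let s : ℤ := if (k₁ + k₂ + k₃ + k₄ + k₅ + k₆) % 2 = 0 then 1 else -1
  s * (binom (a 7) k₁ * binom (a 6) k₂ * binom (a 3) k₃ * binom (a 8) k₄ * binom (a 9) k₅ * binom (a 0) k₆ : ℕ)
    * shiftBinom (b 6) ((b 5 : ℤ) - k₁ - k₂)
    * shiftBinom (b 7) ((b 5 : ℤ) + b 6 - k₁ - k₂ - k₃)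
    * shiftBinom (b 8) ((a 6 : ℤ) + b 7 - k₂ - k₃ - k₄)
    * shiftBinom (b 9) ((b 7 : ℤ) + b 8 - k₃ - k₄)
    * shiftBinom (b 0) ((a 7 : ℤ) + b 9 - k₃ - k₅)
    * shiftBinom (b 1) ((b 2 : ℤ) + b 3 - k₃ - k₅ - k₆)
    * shiftBinom (b 2) ((b 3 : ℤ) - k₅ - k₆)

/-- Sum of `f k` for `k = 0, …, n` (plain structural recursion, so that `decide` evaluates it in the kernel). -/
def sumUpTo (n : ℕ) (f : ℕ → ℤ) : ℤ := Nat.rec (f 0) (fun k acc => acc + f (k + 1)) n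

/-- `leading a b` = the 6-fold terminating sum `Σ_k term a b k` of FAMILY.md §2(c): the torus residue
`(2πi)^{-7} ∮ f(a,b) ω_σ` at a vertex of the closed polar cell, i.e. the constant term
`[y₁^{b₆} y₂^{b₆+b₇} y₃^{a₇+b₈} y₄^{b₈+b₉} y₅^{a₈+b₁₀} y₆^{b₃+b₄} y₇^{b₄}]` of
`(1−y₁y₂)^{a₈}(1−y₁y₂y₃)^{a₇}(1−y₂y₃y₄y₅y₆)^{a₄}(1−y₃y₄)^{a₉}(1−y₅y₆y₇)^{a₁₀}(1−y₆y₇)^{a₁} / ∏_j (1−y_j)^{c_j+1}`.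
CONJECTURALLY (OBSERVED for the basic members `n ≤ 2` against print) the coefficient of `ζ_7` in the cellular integral. -/
def leading (a b : Fin 10 → ℕ) : ℤ :=
  sumUpTo (a 7) fun k₁ => sumUpTo (a 6) fun k₂ => sumUpTo (a 3) fun k₃ =>
    sumUpTo (a 8) fun k₄ => sumUpTo (a 9) fun k₅ => sumUpTo (a 0) fun k₆ => term a b k₁ k₂ k₃ k₄ k₅ k₆

/-- `A(0) = 1`. -/
theorem leading_basic_zero : leading (basic 0) (basic 0) = 1 := by decide

/-- `A(1) = 61` — the `ζ_7`-coefficient of Brown–Zudilin's `I₁` (Sect. 12, p. 30; tree `vim_values`). -/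
theorem leading_basic_one : leading (basic 1) (basic 1) = 61 := by decide

/-- `A(2) = 52921` — the `ζ_7`-coefficient of Brown–Zudilin's `I₂` (Sect. 12, p. 30; tree `vim_values`). -/
theorem leading_basic_two : leading (basic 2) (basic 2) = 52921 := by decide

/-- `A(3) = 94357501` (beyond print; agrees with the seat's three Python implementations, FAMILY.md §3). -/
theorem leading_basic_three : leading (basic 3) (basic 3) = 94357501 := by decide

/-- `A(4) = 235634763001` (beyond print; idem). -/
theorem leading_basic_four : leading (basic 4) (basic 4) = 235634763001 := by decide


end Summit.KontsevichZagierPeriods.Zeta5Search.Cells.VanishingMiddleLeading
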